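import Summits.QuantumFields.YangMills.Theses.MarkovAtoms
import Summits.QuantumFields.YangMills.Theorems.BalabanLadderInfVolCeilingsDLR
import HarnessLib

/-!
# Route `MarkovAtoms`, support `MarkovHolder` (stmt-QuantumFields-22740) — MARKOV × HÖLDER, from the tree's DLR package

For every DLR state `μ` of the Wilson specification (`ymGibbsMeasures`), every `n ≥ 1` bounded continuous cylinder observables
`A₁ … Aₙ` carried by the interior links of pairwise separated cubes (a full lattice layer between any two):
`|E_μ ∏ᵢ (Aᵢ − E_μ Aᵢ)| ≤ ∏ᵢ ‖kerE_{cube i}(Aᵢ) − E_μ Aᵢ‖_{Lⁿ(μ)}`.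

Proof: §1 the EXACT conditional-independence identity `E_μ ∏ᵢ (Aᵢ − E Aᵢ) = E_μ ∏ᵢ (γ_{Λᵢ}Aᵢ − E Aᵢ)` for mutually far
volumes (one DLR step per factor — the mechanism of the tree's Gibbs collar `InfiniteVolume.abs_integral_prod_sub_mean_le_of_isGibbsMeasure`,
here recorded as an identity instead of a sup bound: DLR equation `IsGibbsMeasure.integral_integral_eq`, pull-out of exterior factors,
quasilocality `dependsOn_integral_ymSpecification`); §2 generalized Hölder with exponents `n` (Mathlib `ENNReal.lintegral_prod_norm_pow_le`
read for bounded real integrands); §3 the cube geometry (separated cubes are far: the links of a cube and of the plaquettes touching it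
avoid every other cube); §4 the item.

Free-hands width seat `ym-t4-w11` (cell ym-fleet) for planner ym-idea-11 g7.  THEOREMS ONLY (no `def`, no `sorry`).  This is a
SUPPORT (measure theory on the tree's DLR objects); no summit / leaf / NT / mass-gap statement is proved.

References: H.-O. Georgii, *Gibbs Measures and Phase Transitions* (2011) Def. 1.23, Rem. 1.24, (2.15) [Georgii2011]; S. Friedli,
Y. Velenik, *Statistical Mechanics of Lattice Systems* (2017) ch. 6 [FriedliVelenik2017]; E. Seiler, LNP 159 (1982) Ch. 2.
-/

set_option autoImplicit false

noncomputable section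

open MeasureTheory Filter Topology Finset
open scoped BigOperators ENNReal
open Literature.MathematicalPhysics.QuantumFieldTheory hiding ZdEdge
open Literature.MathematicalPhysics.QuantumLattice hiding cubeEdges
open Literature.Probability.LatticeModels
open Summit.QuantumFields.YangMills.Cruxes.OSLegsFromFemtoAndGap.DlrCollarTransfer
open Summit.QuantumFields.YangMills.Theorems.InfiniteVolume
  (integral_mul_eq_integral_kernelMean_mul dependsOn_finset_prod)

namespace Summit.QuantumFields.YangMills.Theorems.MarkovAtoms

/-! ## §1 Conditional independence of separated volumes in a DLR state — as an identity -/

section Identity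

variable {d N : ℕ} {G : Type} [Group G] [TopologicalSpace G] [IsTopologicalGroup G] [CompactSpace G]
  [MeasurableSpace G] [BorelSpace G] (ρ : G →* Matrix (Fin N) (Fin N) ℂ)

/-- **Markov property of the Wilson specification, product form.**  Let `μ` be a DLR state of `ymSpecification ρ β` (`T₂`, second
countable compact `G`, continuous `ρ`), `A₁, …, Aₙ` continuous bounded cylinder observables with `Aᵢ` carried by the link set `Λᵢ`, the
volumes mutually far (for `i ≠ j` the links of `Λⱼ` and of the plaquettes touching `Λⱼ` avoid `Λᵢ`).  Then
`∫ ∏ᵢ (Aᵢ − ∫Aᵢ dμ) dμ = ∫ ∏ᵢ (γ_{Λᵢ}Aᵢ(η) − ∫Aᵢ dμ) dμ(η)` — the joint centred moment factorises through the conditional means.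
(One DLR step per factor; the already-conditioned factors are cylinders on `Λᵢ ∪ ∂Λᵢ`, hence exterior to the later volumes.)
[cite: Georgii2011, Def. 1.23 / Rem. 1.24 / (2.15)] -/
theorem integral_prod_sub_mean_eq_integral_prod_kernelMean [T2Space G] [SecondCountableTopology G]
    (hρ : Continuous ρ) {β : ℝ} {μ : Measure (LGConfig d G)} (hμ : IsGibbsMeasure (ymSpecification (d := d) ρ β) μ)
    {n : ℕ} (Λ : Fin n → Finset (ZdEdge d)) (A : Fin n → LGConfig d G → ℝ) (hAc : ∀ i, Continuous (A i))
    {CA : ℝ} (hAb : ∀ i U, |A i U| ≤ CA) (hAS : ∀ i, IsCylinder (A i) (Λ i))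
    (hfar : ∀ i j : Fin n, i ≠ j →
      Disjoint (Λ j ∪ (plaquettesTouching (Λ j)).biUnion plaquetteEdges) (Λ i)) :
    ∫ U, ∏ i, (A i U - ∫ V, A i V ∂μ) ∂μ =
      ∫ η, ∏ i, ((∫ U, A i U ∂(ymSpecification ρ β (Λ i) η)) - ∫ V, A i V ∂μ) ∂μ := by
  classical
  haveI := hμ.isProbabilityMeasure
  have hγ : IsSpecification (ymSpecification (d := d) ρ β) := isSpecification_ymSpecification_of_t2Space ρ hρ β
  have hAm : ∀ i, Measurable (A i) := fun i => (hAc i).measurable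
  -- the state means `m i` and the conditioned factors `h i`
  set m : Fin n → ℝ := fun i => ∫ V, A i V ∂μ with hm
  set h : Fin n → LGConfig d G → ℝ := fun i η => (∫ U, A i U ∂(ymSpecification ρ β (Λ i) η)) - m i with hh
  -- properties of `h i`: bounded by `2 CA`, continuous, cylinder on `Λ i ∪ ∂Λ i`
  have hCA0 : ∀ i : Fin n, 0 ≤ CA := fun i => (abs_nonneg _).trans (hAb i (fun _ => 1))
  have hmb : ∀ i, |m i| ≤ CA := fun i => abs_integral_le_of_abs_le (hAb i)
  have hhb : ∀ i η, |h i η| ≤ 2 * CA := by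
    intro i η
    have h1 := abs_integral_ymSpecification_le ρ hρ β (Λ i) (hAb i) η
    calc |h i η| ≤ |∫ U, A i U ∂(ymSpecification ρ β (Λ i) η)| + |m i| := abs_sub _ _
      _ ≤ CA + CA := add_le_add h1 (hmb i)
      _ = 2 * CA := by ring
  have hhc : ∀ i, Continuous (h i) := fun i =>
    (continuous_integral_ymSpecification ρ hρ β (Λ i) (hAc i) (hAb i)).sub continuous_const
  have hhm : ∀ i, Measurable (h i) := fun i => (hhc i).measurable
  have hhS : ∀ i, IsCylinder (h i) (Λ i ∪ (plaquettesTouching (Λ i)).biUnion plaquetteEdges) := by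
    intro i U V hUV
    simp only [hh]
    exact congrArg (fun t : ℝ => t - m i) (dependsOn_integral_ymSpecification ρ hρ β (Λ i) (hAm i) (hAS i) hUV)
  have hAmb : ∀ i U, |A i U - m i| ≤ 2 * CA := fun i U =>
    (abs_sub _ _).trans (by linarith [hAb i U, hmb i])
  -- the hybrid integrands
  let fac : ℕ → Fin n → LGConfig d G → ℝ := fun k i U => if (i : ℕ) < k then h i U else (A i U - m i)
  have hfacm : ∀ k i, Measurable (fac k i) := by
    intro k i
    by_cases hik : (i : ℕ) < k
    · simp only [fac, hik, if_true]; exact hhm i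
    · simp only [fac, hik, if_false]; exact (hAm i).sub measurable_const
  have hfacb : ∀ k i U, |fac k i U| ≤ 2 * CA := by
    intro k i U
    by_cases hik : (i : ℕ) < k
    · simp only [fac, hik, if_true]; exact hhb i U
    · simp only [fac, hik, if_false]; exact hAmb i U
  have hfacS : ∀ k i, DependsOn (fac k i)
      (↑(Λ i ∪ (plaquettesTouching (Λ i)).biUnion plaquetteEdges) : Set (ZdEdge d)) := by
    intro k i U V hUV
    by_cases hik : (i : ℕ) < k
    · simp only [fac, hik, if_true]; exact hhS i hUV
    · simp only [fac, hik, if_false]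
      rw [hAS i fun e he => hUV e (by rw [Finset.coe_union]; exact Or.inl he)]
  -- one step: replacing the `k`-th centred factor by `h k` does not change the integral
  have hstep : ∀ k : ℕ, ∀ hk : k < n,
      ∫ U, ∏ i, fac k i U ∂μ = ∫ U, ∏ i, fac (k + 1) i U ∂μ := by
    intro k hk
    set k' : Fin n := ⟨k, hk⟩ with hk'
    set H : LGConfig d G → ℝ := fun U => ∏ i ∈ univ.erase k', fac k i U with hH
    have hHeq : ∀ U, ∏ i ∈ univ.erase k', fac (k + 1) i U = H U := by
      intro U
      refine Finset.prod_congr rfl fun i hi => ?_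
      have hne : (i : ℕ) ≠ k := fun e => (Finset.mem_erase.1 hi).1 (Fin.ext e)
      by_cases hik : (i : ℕ) < k
      · have : (i : ℕ) < k + 1 := by omega
        simp only [fac, hik, this, if_true]
      · have : ¬ (i : ℕ) < k + 1 := by omega
        simp only [fac, hik, this, if_false]
    have hsplit : ∀ (j : ℕ) (U : LGConfig d G), ∏ i, fac j i U = fac j k' U * ∏ i ∈ univ.erase k', fac j i U :=
      fun j U => (Finset.mul_prod_erase univ (fun i => fac j i U) (Finset.mem_univ k')).symm
    have hk0 : fac k k' = fun U => A k' U - m k' := by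
      funext U; simp only [fac, hk', lt_irrefl, if_false]
    have hk1 : fac (k + 1) k' = h k' := by
      funext U; simp only [fac, hk', Nat.lt_succ_self, if_true]
    have hHm : Measurable H := Finset.measurable_prod _ fun i _ => hfacm k i
    have hHb : ∀ U, |H U| ≤ (2 * CA) ^ (univ.erase k').card := fun U =>
      abs_prod_le_pow _ (fun i _ V => hfacb k i V) U
    have hHdep : DependsOn H ((↑(Λ k') : Set (ZdEdge d))ᶜ) := by
      refine dependsOn_finset_prod _ fun i hi => (hfacS k i).mono ?_
      have hne : k' ≠ i := fun e => (Finset.mem_erase.1 hi).1 e.symm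
      have hd := hfar k' i hne
      intro e he heΛ
      exact Finset.disjoint_left.1 hd (Finset.mem_coe.1 he) heΛ
    calc ∫ U, ∏ i, fac k i U ∂μ = ∫ U, (A k' U - m k') * H U ∂μ := by
          refine integral_congr_ae (ae_of_all _ fun U => ?_)
          change ∏ i, fac k i U = _
          rw [hsplit k U, hk0]
      _ = ∫ η, (∫ U, (A k' U - m k') ∂(ymSpecification ρ β (Λ k') η)) * H η ∂μ :=
          integral_mul_eq_integral_kernelMean_mul ρ hρ hγ hμ (Λ k') ((hAm k').sub measurable_const)
            (hAmb k') hHm hHb hHdep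
      _ = ∫ η, h k' η * H η ∂μ := by
          refine integral_congr_ae (ae_of_all _ fun η => ?_)
          change (∫ U, (A k' U - m k') ∂(ymSpecification ρ β (Λ k') η)) * H η = h k' η * H η
          haveI := isProbabilityMeasure_ymSpecification ρ hρ β (Λ k') η
          rw [integral_sub_const_of_abs_le (hAm k') (hAb k') (m k')]
      _ = ∫ U, ∏ i, fac (k + 1) i U ∂μ := by
          refine integral_congr_ae (ae_of_all _ fun U => ?_)
          change h k' U * H U = ∏ i, fac (k + 1) i U
          rw [hsplit (k + 1) U, hk1, hHeq U]
  -- iterate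
  have hiter : ∀ k : ℕ, k ≤ n → ∫ U, ∏ i, fac 0 i U ∂μ = ∫ U, ∏ i, fac k i U ∂μ := by
    intro k
    induction k with
    | zero => intro; rfl
    | succ k ih => intro hk; rw [ih (Nat.le_of_succ_le hk), hstep k hk]
  have h0 : ∀ U, ∏ i, fac 0 i U = ∏ i, (A i U - m i) := fun U =>
    Finset.prod_congr rfl fun i _ => by simp only [fac, Nat.not_lt_zero, if_false]
  have hn : ∀ U, ∏ i, fac n i U = ∏ i, h i U := fun U =>
    Finset.prod_congr rfl fun i _ => by simp only [fac, i.isLt, if_true]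
  have := hiter n le_rfl
  simp only [h0, hn] at this
  exact this

end Identity

/-! ## §2 Generalized Hölder with exponents `n` for bounded real integrands -/

section Holder

variable {Ω : Type*} [MeasurableSpace Ω] {μ : Measure Ω} [IsProbabilityMeasure μ]

/-- **Generalized Hölder inequality** (`n` factors, each in `Lⁿ`): for `n ≥ 1` bounded measurable real `h₁, …, hₙ` on a probability
space, `|∫ ∏ᵢ hᵢ dμ| ≤ ∏ᵢ (∫ |hᵢ|ⁿ dμ)^{1/n}` (Mathlib `ENNReal.lintegral_prod_norm_pow_le` with equal exponents `1/n`, read for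
bounded real integrands). [cite: FriedliVelenik2017, ch. 6] -/
theorem abs_integral_prod_le_prod_lpNorm {n : ℕ} (hn : 1 ≤ n) (h : Fin n → Ω → ℝ) (hm : ∀ i, Measurable (h i))
    {C : ℝ} (hb : ∀ i ω, |h i ω| ≤ C) :
    |∫ ω, ∏ i, h i ω ∂μ| ≤ ∏ i, (∫ ω, |h i ω| ^ n ∂μ) ^ ((1 : ℝ) / n) := by
  have hn0 : n ≠ 0 := by omega
  -- the pieces: `|h i|ⁿ` and `∏ |h i|` are bounded measurable, hence integrable
  have habsm : ∀ i, Measurable fun ω => |h i ω| := fun i => continuous_abs.measurable.comp (hm i)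
  have hpow_m : ∀ i, Measurable fun ω => |h i ω| ^ n := fun i => (habsm i).pow_const n
  have hpow_b : ∀ i ω, |(|h i ω| ^ n)| ≤ C ^ n := fun i ω => by
    rw [abs_of_nonneg (pow_nonneg (abs_nonneg _) _)]
    exact pow_le_pow_left₀ (abs_nonneg _) (hb i ω) n
  have hpow_int : ∀ i, Integrable (fun ω => |h i ω| ^ n) μ := fun i => integrable_of_abs_le (hpow_m i) (hpow_b i)
  have hG0 : ∀ i, 0 ≤ ∫ ω, |h i ω| ^ n ∂μ := fun i => integral_nonneg fun ω => pow_nonneg (abs_nonneg _) _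
  set F : Ω → ℝ := fun ω => ∏ i, |h i ω| with hF
  have hFnn : ∀ ω, 0 ≤ F ω := fun ω => Finset.prod_nonneg fun i _ => abs_nonneg _
  have hFm : Measurable F := Finset.measurable_prod _ fun i _ => habsm i
  have hFb : ∀ ω, |F ω| ≤ C ^ (univ : Finset (Fin n)).card := fun ω =>
    abs_prod_le_pow _ (fun i _ ω' => (abs_abs (h i ω')).trans_le (hb i ω')) ω
  have hFint : Integrable F μ := integrable_of_abs_le hFm hFb
  -- Hölder in `ℝ≥0∞` with the equal exponents `1/n`
  have hsum : ∑ _i : Fin n, (1 : ℝ) / n = 1 := by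
    rw [Finset.sum_const, Finset.card_univ, Fintype.card_fin, nsmul_eq_mul]
    field_simp
  have key := ENNReal.lintegral_prod_norm_pow_le (μ := μ) (univ : Finset (Fin n))
    (f := fun i ω => ENNReal.ofReal (|h i ω| ^ n)) (fun i _ => (hpow_m i).ennreal_ofReal.aemeasurable)
    (p := fun _ => (1 : ℝ) / n) hsum (fun i _ => by positivity)
  have hL : ∀ ω, ∏ i, ENNReal.ofReal (|h i ω| ^ n) ^ ((1 : ℝ) / n) = ENNReal.ofReal (F ω) := by
    intro ω
    rw [hF, ENNReal.ofReal_prod_of_nonneg (fun i _ => abs_nonneg _)]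
    refine Finset.prod_congr rfl fun i _ => ?_
    rw [ENNReal.ofReal_rpow_of_nonneg (pow_nonneg (abs_nonneg _) _) (by positivity), one_div,
      Real.pow_rpow_inv_natCast (abs_nonneg _) hn0]
  have hR : ∀ i, (∫⁻ ω, ENNReal.ofReal (|h i ω| ^ n) ∂μ) ^ ((1 : ℝ) / n) =
      ENNReal.ofReal ((∫ ω, |h i ω| ^ n ∂μ) ^ ((1 : ℝ) / n)) := by
    intro i
    rw [← ofReal_integral_eq_lintegral_ofReal (hpow_int i) (ae_of_all _ fun ω => pow_nonneg (abs_nonneg _) _),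
      ENNReal.ofReal_rpow_of_nonneg (hG0 i) (by positivity)]
  simp only [hL, hR] at key
  rw [← ofReal_integral_eq_lintegral_ofReal hFint (ae_of_all _ hFnn),
    ← ENNReal.ofReal_prod_of_nonneg (fun i _ => Real.rpow_nonneg (hG0 i) _)] at key
  have hfin := (ENNReal.ofReal_le_ofReal_iff (Finset.prod_nonneg fun i _ => Real.rpow_nonneg (hG0 i) _)).1 key
  calc |∫ ω, ∏ i, h i ω ∂μ| ≤ ∫ ω, |∏ i, h i ω| ∂μ := abs_integral_le_integral_abs
    _ = ∫ ω, F ω ∂μ := by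
        refine integral_congr_ae (ae_of_all _ fun ω => ?_)
        change |∏ i, h i ω| = ∏ i, |h i ω|
        exact Finset.abs_prod _ _
    _ ≤ ∏ i, (∫ ω, |h i ω| ^ n ∂μ) ^ ((1 : ℝ) / n) := hfin

end Holder

/-! ## §3 Separated cubes are far -/

/-- **A full lattice layer between two cubes separates them for the Wilson specification**: if in some coordinate `k` the cube
`(c, N)` ends at least two sites before the cube `(c', N')` begins (or vice versa), then the interior links of `(c', N')` and the links of
the plaquettes touching them avoid the interior links of `(c, N)` (no plaquette meets both cubes). [folklore] -/
theorem cubeEdges_far_of_gap {c c' : Fin 4 → ℤ} {N N' : ℕ} {k : Fin 4}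
    (hk : c k + N + 1 ≤ c' k ∨ c' k + N' + 1 ≤ c k) :
    Disjoint (cubeEdges c' N' ∪ (plaquettesTouching (cubeEdges c' N')).biUnion plaquetteEdges) (cubeEdges c N) := by
  have hwin : ∀ {c₀ : Fin 4 → ℤ} {N₀ : ℕ} {e₀ : Literature.MathematicalPhysics.QuantumLattice.ZdEdge 4},
      e₀ ∈ cubeEdges c₀ N₀ → c₀ k ≤ e₀.1 k ∧ e₀.1 k < c₀ k + N₀ := fun he₀ => by
    have := Fintype.mem_piFinset.1 (fst_mem_cubeSites_of_mem_cubeEdges he₀) k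
    exact Finset.mem_Ico.1 this
  refine Finset.disjoint_left.2 fun e he he' => ?_
  have h2 := hwin he'
  have h1 : c' k - 1 ≤ e.1 k ∧ e.1 k ≤ c' k + N' := by
    rcases Finset.mem_union.1 he with h | h
    · have := hwin h; constructor <;> omega
    · obtain ⟨e₀, he₀, hnear⟩ := exists_near_of_mem_plaquettesTouching_biUnion h
      have := hwin he₀
      have hn := abs_le.1 (hnear k)
      constructor <;> omega
  omega

/-! ## §4 The item -/

/-- **`MarkovAtoms.MarkovHolder` (stmt-QuantumFields-22740) PROVED — MARKOV × HÖLDER.**  For SU(2)-class `G` (any compact `G` with a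
lattice representation in fact), every DLR state `μ ∈ ymGibbsMeasures r.ρ β`, every `n ≥ 1` bounded continuous cylinder observables `Aᵢ`
on the interior links of pairwise separated cubes `(cᵢ, Nᵢ)`:
`|∫ ∏ᵢ (Aᵢ − ∫Aᵢ dμ) dμ| ≤ ∏ᵢ (∫ |kerE_{(cᵢ,Nᵢ)}(η)(Aᵢ) − ∫Aᵢ dμ|ⁿ dμ(η))^{1/n}` — §1 (conditional independence) + §2 (Hölder) + §3.
[cite: Georgii2011, Def. 1.23 / (2.15); FriedliVelenik2017, ch. 6] -/
theorem markovHolder_proof : Summit.QuantumFields.YangMills.Theses.MarkovAtoms.MarkovHolder := by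
  intro G _ _ _ _ _hG _hiso r β μ hμ n c N A K hn hAc hAb hAS hsep
  letI : MeasurableSpace G := borel G
  haveI : BorelSpace G := ⟨rfl⟩
  haveI : SecondCountableTopology G :=
    (r.continuous.isClosedEmbedding r.injective).isEmbedding.secondCountableTopology
  haveI : T2Space G := (r.continuous.isClosedEmbedding r.injective).isEmbedding.t2Space
  have hμ' : IsGibbsMeasure (ymSpecification (d := 4) r.ρ β) μ := hμ
  haveI := hμ'.isProbabilityMeasure
  have hfar : ∀ i j : Fin n, i ≠ j →
      Disjoint (cubeEdges (c j) (N j) ∪ (plaquettesTouching (cubeEdges (c j) (N j))).biUnion plaquetteEdges)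
        (cubeEdges (c i) (N i)) := by
    intro i j hij
    obtain ⟨k, hk⟩ := hsep i j hij
    exact cubeEdges_far_of_gap hk
  have key := integral_prod_sub_mean_eq_integral_prod_kernelMean r.ρ r.continuous hμ'
    (fun i => cubeEdges (c i) (N i)) A hAc hAb hAS hfar
  -- the conditioned, centred factors
  have hKm : ∀ i, Measurable fun η => kerE G r β (c i) (N i) η (A i) - ∫ V, A i V ∂μ := fun i => by
    unfold kerE
    exact (continuous_integral_ymSpecification r.ρ r.continuous β _ (hAc i) (hAb i)).measurable.sub measurable_const
  have hmb : ∀ i, |∫ V, A i V ∂μ| ≤ K := fun i => abs_integral_le_of_abs_le (hAb i)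
  have hKb : ∀ i η, |kerE G r β (c i) (N i) η (A i) - ∫ V, A i V ∂μ| ≤ 2 * K := fun i η => by
    have h1 : |kerE G r β (c i) (N i) η (A i)| ≤ K := by
      unfold kerE; exact abs_integral_ymSpecification_le r.ρ r.continuous β _ (hAb i) η
    calc |kerE G r β (c i) (N i) η (A i) - ∫ V, A i V ∂μ|
        ≤ |kerE G r β (c i) (N i) η (A i)| + |∫ V, A i V ∂μ| := abs_sub _ _
      _ ≤ K + K := add_le_add h1 (hmb i)
      _ = 2 * K := by ring
  change |∫ U, ∏ i, (A i U - ∫ V, A i V ∂μ) ∂μ| ≤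
    ∏ i, (∫ η, |kerE G r β (c i) (N i) η (A i) - ∫ V, A i V ∂μ| ^ n ∂μ) ^ ((1 : ℝ) / n)
  rw [key]
  exact abs_integral_prod_le_prod_lpNorm hn (fun i η => kerE G r β (c i) (N i) η (A i) - ∫ V, A i V ∂μ) hKm hKb

end Summit.QuantumFields.YangMills.Theorems.MarkovAtoms

end
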